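import Summits.Ventures.PercRepro.RankLevelSetPerElemSix
import Summits.Ventures.PercRepro.RankLevelSetUpNullityFive
import Summits.Ventures.PercRepro.RankLevelSetUpPairNullityFive

/-! # RankLevelSetSixResidues — (★★) AT LEVEL `6` AND MONO'S STEP `6` FOR EVERY FINITE MATROID, MODULO THE TWO NAMED
RESIDUES: THE COLOOP RESIDUE (P) OF THE DELETION-AVERAGING STEP AND THE PAIR FORM OF (↑) AT LEVEL `5` (night-1 g40;
dossier §52.11, §52.15; on `RankLevelSetPerElemSix`, `RankLevelSetUpNullityFive` and `RankLevelSetUpPairNullityFive`)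

`perElemAt_six_of_residues` needs (↑)₅ on every matroid of nullity `≤ 5` with `≥ 12` elements, which
`upAt_five_of_nullity_five_of_residue` supplies from `UpFiveDeletionResidue` on the loopless coloop-free matroids
of nullity exactly `5` without a series triple; the pair (↑)₅ stays a hypothesis. Hence **`perElemAt_six_of_deletion_pair`** and
**`mono_step_six_of_deletion_pair`**: (★★) at level `6` at every element and `(#E − 6) · D_6 ≤ 7 · D_7` on every
finite matroid with `≥ 14` elements, modulo (P) and the pair (↑)₅ on nullity `≤ 5`; with
`upPairAt_five_of_nullity_five_of_residues` the latter splits into the pair (↑)₅ on nullity `≤ 4` and the pair residue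
(P₂) — **`perElemAt_six_of_residues_three`**, **`mono_step_six_of_residues_three`**. Every declaration has a
docstring; imports: the cell's own modules and Mathlib only. Axioms: standard. -/

namespace PercRepro

open Set Matroid

variable {α : Type} (M : Matroid α) [M.Finite]

/-- **(★★) AT LEVEL `6` FOR EVERY FINITE MATROID WITH `≥ 14` ELEMENTS AND EVERY ELEMENT, MODULO THE COLOOP RESIDUE
(P) ON THE LOOPLESS COLOOP-FREE MATROIDS OF NULLITY `5` WITHOUT A SERIES TRIPLE AND THE PAIR (↑)₅ ON NULLITY
`≤ 5`.** -/
theorem perElemAt_six_of_deletion_pair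
    (hres : ∀ (N : Matroid α) [N.Finite], (∀ e, ¬ N.IsLoop e) → (∀ e, ¬ N.IsColoop e) → NoSeriesTriple N →
      N✶.eRank = 5 → 12 ≤ N.E.ncard → ∀ b ∈ N.E, UpFiveDeletionResidue N b)
    (hpair : ∀ (N : Matroid α) [N.Finite], N✶.eRank ≤ 5 → 12 ≤ N.E.ncard →
      ∀ b ∈ N.E, ∀ c ∈ N.E, b ≠ c → BiIndepUpPairAt N b c 5)
    {y : α} (hy : y ∈ M.E) (hn : 14 ≤ M.E.ncard) :
    {Z ∈ biIndep M 6 | y ∉ Z}.ncard ≤ {Q ∈ biIndep M 7 | y ∈ Q}.ncard :=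
  perElemAt_six_of_residues M
    (fun N _ hν h12 _ hb => upAt_five_of_nullity_five_of_residue hres N hν h12 hb) hpair hy hn

/-- **MONO'S STEP `j = 6` FOR EVERY FINITE MATROID WITH `≥ 14` ELEMENTS, MODULO THE SAME TWO RESIDUES**:
`(#E − 6) · D_6 ≤ 7 · D_7`. -/
theorem mono_step_six_of_deletion_pair
    (hres : ∀ (N : Matroid α) [N.Finite], (∀ e, ¬ N.IsLoop e) → (∀ e, ¬ N.IsColoop e) → NoSeriesTriple N →
      N✶.eRank = 5 → 12 ≤ N.E.ncard → ∀ b ∈ N.E, UpFiveDeletionResidue N b)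
    (hpair : ∀ (N : Matroid α) [N.Finite], N✶.eRank ≤ 5 → 12 ≤ N.E.ncard →
      ∀ b ∈ N.E, ∀ c ∈ N.E, b ≠ c → BiIndepUpPairAt N b c 5)
    (hn : 14 ≤ M.E.ncard) : (M.E.ncard - 6) * biIndepCount M 6 ≤ 7 * biIndepCount M 7 :=
  mono_step_of_perElemAt M 6 (fun _ hy => perElemAt_six_of_deletion_pair M hres hpair hy hn)

/-- **(★★) AT LEVEL `6` FOR EVERY FINITE MATROID WITH `≥ 14` ELEMENTS AND EVERY ELEMENT, MODULO THREE NAMED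
STATEMENTS**: the coloop residue (P) on the loopless coloop-free matroids of nullity `5` without a series triple, the
pair coloop residue (P₂) on the loopless matroids of nullity `5`, and the pair (↑)₅ on the matroids of nullity `≤ 4`. -/
theorem perElemAt_six_of_residues_three
    (hres : ∀ (N : Matroid α) [N.Finite], (∀ e, ¬ N.IsLoop e) → (∀ e, ¬ N.IsColoop e) → NoSeriesTriple N →
      N✶.eRank = 5 → 12 ≤ N.E.ncard → ∀ b ∈ N.E, UpFiveDeletionResidue N b)
    (hres₂ : ∀ (N : Matroid α) [N.Finite], (∀ e, ¬ N.IsLoop e) → N✶.eRank = 5 → 12 ≤ N.E.ncard →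
      ∀ b ∈ N.E, ∀ c ∈ N.E, b ≠ c → UpPairFiveDeletionResidue N b c)
    (h4 : ∀ (N : Matroid α) [N.Finite], N✶.eRank ≤ 4 → 12 ≤ N.E.ncard →
      ∀ b ∈ N.E, ∀ c ∈ N.E, b ≠ c → BiIndepUpPairAt N b c 5)
    {y : α} (hy : y ∈ M.E) (hn : 14 ≤ M.E.ncard) :
    {Z ∈ biIndep M 6 | y ∉ Z}.ncard ≤ {Q ∈ biIndep M 7 | y ∈ Q}.ncard :=
  perElemAt_six_of_deletion_pair M hres
    (fun N _ hν h12 _ hb _ hc hbc => upPairAt_five_of_nullity_five_of_residues h4 hres₂ N hν h12 hb hc hbc) hy hn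

/-- **MONO'S STEP `j = 6` FOR EVERY FINITE MATROID WITH `≥ 14` ELEMENTS, MODULO THE SAME THREE STATEMENTS.** -/
theorem mono_step_six_of_residues_three
    (hres : ∀ (N : Matroid α) [N.Finite], (∀ e, ¬ N.IsLoop e) → (∀ e, ¬ N.IsColoop e) → NoSeriesTriple N →
      N✶.eRank = 5 → 12 ≤ N.E.ncard → ∀ b ∈ N.E, UpFiveDeletionResidue N b)
    (hres₂ : ∀ (N : Matroid α) [N.Finite], (∀ e, ¬ N.IsLoop e) → N✶.eRank = 5 → 12 ≤ N.E.ncard →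
      ∀ b ∈ N.E, ∀ c ∈ N.E, b ≠ c → UpPairFiveDeletionResidue N b c)
    (h4 : ∀ (N : Matroid α) [N.Finite], N✶.eRank ≤ 4 → 12 ≤ N.E.ncard →
      ∀ b ∈ N.E, ∀ c ∈ N.E, b ≠ c → BiIndepUpPairAt N b c 5)
    (hn : 14 ≤ M.E.ncard) : (M.E.ncard - 6) * biIndepCount M 6 ≤ 7 * biIndepCount M 7 :=
  mono_step_of_perElemAt M 6 (fun _ hy => perElemAt_six_of_residues_three M hres hres₂ h4 hy hn)

end PercRepro
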